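import Summits.HodgeConjecture.HodgeConjecture.Theorems.Ring2AbelianAllAndreLiebermanDischargedRows
import HarnessLib

/-!
# Ring 2 · sub-cell AbelianAll, André axis, part XXII-h — GROTHENDIECK'S STANDARD CONJECTURES FOR COMPLEX ABELIAN VARIETIES
# ON THE REAL CARRIERS, SUMMARY FORMS: `B(A)` in Kleiman's `θ`-form, `A(A, η)`, and `D(A)` (hom ≡ num) — all unconditional

HONEST FRAMING (page 1, verbatim): **research route, not a corollary; conditional on HC_CM plus one named
minimal statement.** Cell line: research route conditional on HC_CM; not a corollary; Q11.4-sentence-2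
already refuted in dim ≥ 3. Nothing in this file proves a case of the Hodge conjecture; `HC_CM` does not occur.
Seat `pub-hodge-ring2-ab-andre-2`, gen 14. One-name corollaries of parts XXII-c/d for consumers outside the pencil
language (every statement about ONE complex abelian variety `A`, no pencil, no binder):

* **`exists_algebraic_inverseLefschetz_abelianVariety`** — Grothendieck's original form of `B(A)` (Kleiman 1968 §2 / 1994 4.1,
  "`θ`-form"): for a polarisation class `η` and `b + r = g`, there is `θ : H^{b+2r}(A(ℂ)) → Hᵇ(A(ℂ))` INDUCED BY AN ALGEBRAIC CLASS
  with `θ ∘ Lʳ = id` and `Lʳ ∘ θ = id` (namely `θ = *_L`, part XXII-c);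
* **`standardConjectureA_abelianVariety`** — `A(A, η)` (Grothendieck's `A`: `Lʳ : Nᵖ → N^{g-p}` onto), one-`η` form of part XXII-d;
* **`nondegenerate_algebraicClasses_abelianVariety`** — Lieberman's `D(A)` on the carriers: the cup pairing
  `Nᵖ H^{2p}(A(ℂ)) × N^q H^{2q}(A(ℂ)) → H^{2g}`, `p + q = g`, is non-degenerate on both sides (numerically trivial algebraic
  classes are homologically trivial; `ℂ`-spans), from `A(A)` by Kleiman's `A ⟹ D` (part XVIII-d, tree).

## What is proved (theorems only; no definition, no named fact, no sorry)

EDGE LABELS: all K. References: Kleiman1968AlgebraicCycles (§2, §3 Cor. 3.9, App. 2A11); Kleiman1994 (4.1); Lieberman1968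
(main theorems); Grothendieck1968 (§3 p. 196).
-/

noncomputable section

set_option linter.dupNamespace false

namespace Summit.HodgeConjecture.HodgeConjecture.Ring2.AbelianAll

open CategoryTheory AlgebraicGeometry
open Literature.AlgebraicGeometry Literature.AlgebraicGeometry.Motives
open Literature.AlgebraicGeometry.HodgeTheory
open Literature.AlgebraicTopology.SingularHomology (singularCohomology cupProduct)
open Literature.Geometry.Kaehler (lefschetzPow HasHardLefschetzProperty)

/-- **`B(A)` in Grothendieck's / Kleiman's `θ`-form, on the real carriers**: for a complex abelian variety `A` of dimension
`g`, a polarisation class `η`, and `b + r = g`, there is a `ℂ`-linear `θ : H^{b+2r}(A(ℂ); ℂ) → Hᵇ(A(ℂ); ℂ)` induced by an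
algebraic class on `A × A` which is a two-sided inverse of the hard-Lefschetz isomorphism `Lʳ = (η ∪ ·)ʳ : Hᵇ → H^{b+2r}`
("there exists an algebraic `ℚ`-cycle on `A × A` which determines the inverse isomorphism"). `θ` is André's `*_L` in that
degree (part XXII-c `standardConjectureBStar_abelianVariety`; `lefschetzInvolution_lefschetzPow`, `lefschetzPow_lefschetzInvolution`).
[cite: Kleiman1968AlgebraicCycles, §2 and Appendix to §2, Thm. 2A11] [cite: Kleiman1994, 4.1] [cite: Lieberman1968, main theorem] -/
theorem exists_algebraic_inverseLefschetz_abelianVariety (A : AbelianVariety ℂ) {η : complexBetti A.X 2}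
    (hη : IsPolarizationClass A.dim A.X η) {b r : ℕ} (hbr : b + r = A.dim) :
    ∃ θ : complexBetti A.X (b + 2 * r) →ₗ[ℂ] complexBetti A.X b,
      IsAlgebraicCorrespondence A.dim A.dim A.X A.X θ ∧
      (∀ x : complexBetti A.X b, θ (lefschetzPow η r b x) = x) ∧
      (∀ y : complexBetti A.X (b + 2 * r), lefschetzPow η r b (θ y) = y) :=
  ⟨lefschetzInvolution hη.hasHardLefschetz (show b + 2 * r + b = 2 * A.dim by omega),
    standardConjectureBStar_abelianVariety A η hη _ _ _,
    fun x ↦ lefschetzInvolution_lefschetzPow hη.hasHardLefschetz hbr _ x,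
    fun y ↦ lefschetzPow_lefschetzInvolution hη.hasHardLefschetz hbr _ y⟩

/-- **`A(A, η)` for a complex abelian variety and a polarisation class** (one-`η` form of part XXII-d's
`forall_standardConjectureA_abelianVariety`): Grothendieck's standard conjecture of Lefschetz type in form `A`, i.e. hard
Lefschetz for `η` together with the surjectivity of `L^{g-2p} : Nᵖ → N^{g-p}` on algebraic classes, holds unconditionally.
[cite: Grothendieck1968, §3 p. 196 (A(X))] [cite: Kleiman1968AlgebraicCycles, §2] [cite: Lieberman1968, main theorem] -/
theorem standardConjectureA_abelianVariety (A : AbelianVariety ℂ) {η : complexBetti A.X 2}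
    (hη : IsPolarizationClass A.dim A.X η) : StandardConjectureA A.dim A.X η :=
  forall_standardConjectureA_abelianVariety A η hη

/-- **Lieberman's `D(A)` on the real carriers: hom ≡ num for complex abelian varieties** (the `ℂ`-spans of cycle classes):
for `p + q = dim A`, an algebraic class of codimension `p` cup-orthogonal to all algebraic classes of codimension `q`
vanishes, and symmetrically — Kleiman's `A ⟹ D` (part XVIII-d `nondegenerate_algebraicClasses_of_standardConjectureA`, which
picks a Kähler–rational polarisation of `A`) with `A(A)` unconditional (§ above). [cite: Lieberman1968, main theorem]
[cite: Kleiman1968AlgebraicCycles, §3 Cor. 3.9] -/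
theorem nondegenerate_algebraicClasses_abelianVariety (A : AbelianVariety ℂ) {p q : ℕ} (hpq : p + q = A.dim) :
    (∀ ξ ∈ algebraicClasses A.X p,
        (∀ b ∈ algebraicClasses A.X q, cupProduct (show 2 * p + 2 * q = 2 * A.dim by omega) ξ b = 0) → ξ = 0) ∧
      (∀ b ∈ algebraicClasses A.X q,
        (∀ ξ ∈ algebraicClasses A.X p, cupProduct (show 2 * p + 2 * q = 2 * A.dim by omega) ξ b = 0) → b = 0) :=
  nondegenerate_algebraicClasses_of_standardConjectureA (AbelianVariety.isSmoothProjective_holds (A := A))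
    (forall_standardConjectureA_abelianVariety A) hpq

end Summit.HodgeConjecture.HodgeConjecture.Ring2.AbelianAll

end
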